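import Mathlib
import Summits.HodgeConjecture.HodgeConjecture.Theorems.HodgeLocusCensusSumPairLaw3

/-!
# Hodge locus census, cell V3-XT, `N = 1` — the `ℚ₃`-fields of the roots of `H_D` (`v₃(D) = 1`): the valuation / Hensel kernel of the SQUARE and PARITY laws

HONEST FRAMING: certified instances and evidence bearing on the general Hodge conjecture; no claim.
This file is a HELPER for the engine-B census of the `α₀`-row (`θ = j(O_D)`, local factors of the class
polynomial `H_D` over `ℚ₃`) of the Hodge-locus programme (`stmt-HodgeConjecture-16267`); it proves no
statement about Hodge classes.  It continues `HodgeLocusCensusSumPairLaw3.lean` (the SUM law at `3`).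

THE SETTING (engine B, abs-2 gen 28, `DERIVATIONS_engineB.md` §24, `DERIVATION-QF3-B.md`).  `D = D₀f² < −4`,
`v₃(D) = 1`, `D ≠ −12`; `K₃ = ℚ₃(√D₀)`, `U = ℚ₃(i)`, `K' = ℚ₃(√(−D₀))`, `M = K₃(i)`.  For a root `θ` of `H_D` and
its Frobenius conjugate `θ' = Frob_{𝔭₃} θ` (locally `i ↦ −i`), `s₁ = θ + θ'`, `s₂ = θθ' ∈ K₃`, `m = v_w(θ) = 3(1+ℓ)`.
THEOREM QF3 (genus criterion; class field theory + Gauss genus theory, not formalised): every root generates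
`U`, `K'` or `M` over `ℚ₃`; the number of roots in `U` is `|Pic(O_D)[2]|` or `0` according as every assigned
character `χ ≠ χ₃` of `D` is even or not, and in `K'` it is `|Pic[2]|` or `0` according as `χ(−1)χ(3) = 1` for all
assigned `χ ≠ χ₃` or not.  THEOREM SQ3 / PARITY: for `m ≥ 9`, `s₂` is a square in `K₃`; a root quadratic over `ℚ₃`
lies in `U` iff `m` is even (`ℓ` odd) and in `K'` iff `m` is odd.  The proof of SQ3/PARITY has three steps:
(1) DISC — from SUM (`v s₁ = g^(2m−6)`, `sum_law3`) and `v s₂ = g^(2m)`: for `m ≥ 7` the discriminant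
    `Δ = s₁² − 4s₂` of `X² − s₁X + s₂` satisfies `v(s₁²) < v(4s₂) = v(Δ)`, i.e. `Δ = −4s₂·(1 − ε)` with `v ε < 1`;
(2) HENSEL at the odd prime `3` — a `1`-unit is a square; hence `Δ ∈ −s₂·(squares)`;
(3) `K₃(√Δ) = K₃(θ) = M = K₃(√−1)` (QF3), so `−s₂ ∼ −1`, `s₂` a square; over `ℚ₃` (quadratic roots) `ℚ₃(θ) = ℚ₃(√−s₂)`,
    unramified iff `v₃(s₂) = m` is even.
Kernel-checked here: (1) for an ARBITRARY valuation with `v 3 = g² < 1` (`disc_dominance`); (2) over `ℤ_[3]`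
(`isSquare_of_norm_sub_one_lt`, from Mathlib's `hensels_lemma`) and its consequence over `ℚ_[3]`
(`disc_square_class`: `Δ = −s₂·(2t)²` with `t ≠ 0`); and the ring identity `(2θ − s₁)² = Δ` (`root_shift_sq`).
Step (3) and QF3 itself are the cited / separately certified part (job qfB28: two routes, `|D| ≤ 2·10⁴`).
-/

set_option linter.dupNamespace false

namespace Summit.HodgeConjecture.HodgeConjecture.HodgeLocus.Census.QF3

open Summit.HodgeConjecture.HodgeConjecture.HodgeLocus.Census.SumPairLaw (pow_lt_pow_of_lt pow_le_pow_of_le)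
open Summit.HodgeConjecture.HodgeConjecture.HodgeLocus.Census.SumPairLaw3 (val_natCast_coprime unif_facts)

section Valued

variable {K : Type*} [Field K] {Γ₀ : Type*} [LinearOrderedCommGroupWithZero Γ₀] (v : Valuation K Γ₀)

/-- DISC.  Hypotheses: `v 3 < 1`, `3 ≠ 0`, `v 3 = g²`; `v s₁ = g^(2m−6)` (the SUM law), `v s₂ = g^(2m)`, `7 ≤ m`.
Conclusions: `v(s₁²) < v(4s₂)`, `v(4s₂) = g^(2m)`, `v(s₁² − 4s₂) = g^(2m)` — the discriminant is dominated by `−4s₂`. -/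
theorem disc_dominance (h3 : v (3 : K) < 1) (h30 : (3 : K) ≠ 0) {g : Γ₀} (hg : v (3 : K) = g ^ 2)
    {s₁ s₂ : K} {m : ℕ} (hm : 7 ≤ m) (h1 : v s₁ = g ^ (2 * m - 6)) (h2 : v s₂ = g ^ (2 * m)) :
    v (s₁ ^ 2) < v (4 * s₂) ∧ v (4 * s₂) = g ^ (2 * m) ∧ v (s₁ ^ 2 - 4 * s₂) = g ^ (2 * m) := by
  obtain ⟨hg0, hg1⟩ := unif_facts v h3 h30 hg
  have v4 : v (4 : K) = 1 := by
    have e : (4 : K) = ((4 : ℕ) : K) := by push_cast; norm_num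
    rw [e, val_natCast_coprime v h3 (by norm_num)]
  have hv4s : v (4 * s₂) = g ^ (2 * m) := by rw [map_mul, v4, one_mul, h2]
  have hlt : v (s₁ ^ 2) < v (4 * s₂) := by
    rw [map_pow, h1, hv4s, ← pow_mul]
    exact pow_lt_pow_of_lt hg0 hg1 (by omega)
  refine ⟨hlt, hv4s, ?_⟩
  have e : s₁ ^ 2 - 4 * s₂ = -(4 * s₂) + s₁ ^ 2 := by ring
  have hlt' : v (s₁ ^ 2) < v (-(4 * s₂)) := by rwa [Valuation.map_neg]
  rw [e, Valuation.map_add_eq_of_lt_left v hlt', Valuation.map_neg, hv4s]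

/-- The `1`-unit form of DISC: `Δ − (−4s₂) = s₁²` is strictly smaller than `−4s₂`, i.e. `Δ/(−4s₂) ≡ 1`. -/
theorem disc_one_unit (h3 : v (3 : K) < 1) (h30 : (3 : K) ≠ 0) {g : Γ₀} (hg : v (3 : K) = g ^ 2)
    {s₁ s₂ : K} {m : ℕ} (hm : 7 ≤ m) (h1 : v s₁ = g ^ (2 * m - 6)) (h2 : v s₂ = g ^ (2 * m)) :
    v ((s₁ ^ 2 - 4 * s₂) - (-(4 * s₂))) < v (-(4 * s₂)) := by
  have h := (disc_dominance v h3 h30 hg hm h1 h2).1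
  have e : (s₁ ^ 2 - 4 * s₂) - (-(4 * s₂)) = s₁ ^ 2 := by ring
  rwa [e, Valuation.map_neg]

end Valued

/-- The root of `X² − s₁X + s₂` and the discriminant: `(2θ − s₁)² = s₁² − 4s₂` (so `F(θ) = F(√Δ)` over any field `F ∋ s₁, s₂` of
characteristic `≠ 2`). -/
theorem root_shift_sq {F : Type*} [CommRing F] {θ s₁ s₂ : F} (h : θ ^ 2 - s₁ * θ + s₂ = 0) :
    (2 * θ - s₁) ^ 2 = s₁ ^ 2 - 4 * s₂ := by
  linear_combination 4 * h

/-- HENSEL at the odd prime `3`: a `3`-adic integer congruent to `1` modulo `3` is a square in `ℤ_[3]`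
(Newton's method for `X² − a` at `1`; `‖2‖₃ = 1`). -/
theorem isSquare_of_norm_sub_one_lt {a : ℤ_[3]} (h : ‖a - 1‖ < 1) : IsSquare a := by
  have h2 : ‖(2 : ℤ_[3])‖ = 1 := by
    have hle : ‖(2 : ℤ_[3])‖ ≤ 1 := PadicInt.norm_le_one _
    have hnlt : ¬ ‖(2 : ℤ_[3])‖ < 1 := by
      have e : (2 : ℤ_[3]) = ((2 : ℤ) : ℤ_[3]) := by push_cast; rfl
      rw [e, PadicInt.norm_int_lt_one_iff_dvd]
      decide
    exact le_antisymm hle (not_lt.mp hnlt)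
  set F : Polynomial ℤ_[3] := Polynomial.X ^ 2 - Polynomial.C a with hF
  have hFa : F.aeval (1 : ℤ_[3]) = 1 - a := by simp [hF]
  have hF'a : (Polynomial.derivative F).aeval (1 : ℤ_[3]) = 2 := by
    simp [hF]
    norm_num
  have hnorm : ‖F.aeval (1 : ℤ_[3])‖ < ‖(Polynomial.derivative F).aeval (1 : ℤ_[3])‖ ^ 2 := by
    rw [hFa, hF'a, h2, one_pow, ← norm_neg, neg_sub]
    exact h
  obtain ⟨z, hz, -, -, -⟩ := hensels_lemma hnorm
  have hz' : z ^ 2 - a = 0 := by simpa [hF] using hz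
  exact ⟨z, by rw [← pow_two]; exact (sub_eq_zero.mp hz').symm⟩

/-- The square class of the discriminant over `ℚ₃` (quadratic roots: `s₁, s₂ ∈ ℚ₃`): if `ε = s₁²/(4s₂)` has
`‖ε‖₃ < 1` then `Δ = s₁² − 4s₂ = −s₂·(2t)²` for some `t ≠ 0`; hence `ℚ₃(√Δ) = ℚ₃(√(−s₂))`, which is unramified
(`= ℚ₃(i)`) iff `v₃(s₂)` is even — the PARITY law, given `v₃(s₂) = m`. -/
theorem disc_square_class {s₁ s₂ : ℚ_[3]} (hs : s₂ ≠ 0) (hε : ‖s₁ ^ 2 / (4 * s₂)‖ < 1) :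
    ∃ t : ℚ_[3], t ≠ 0 ∧ s₁ ^ 2 - 4 * s₂ = -s₂ * (2 * t) ^ 2 := by
  set ε : ℚ_[3] := s₁ ^ 2 / (4 * s₂) with hε_def
  have hu_norm : ‖1 - ε‖ ≤ 1 := by
    calc ‖1 - ε‖ ≤ max ‖(1 : ℚ_[3])‖ ‖ε‖ := by
            rw [sub_eq_add_neg]; exact (Padic.nonarchimedean _ _).trans (by rw [norm_neg])
      _ ≤ 1 := max_le (by simp) hε.le
  set u : ℤ_[3] := ⟨1 - ε, hu_norm⟩ with hu
  have hu1 : ‖u - 1‖ < 1 := by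
    have : ‖((u - 1 : ℤ_[3]) : ℚ_[3])‖ = ‖-ε‖ := by
      congr 1; push_cast; simp [hu]
    rw [PadicInt.norm_def, this, norm_neg]; exact hε
  obtain ⟨r, hr⟩ := isSquare_of_norm_sub_one_lt hu1
  refine ⟨(r : ℚ_[3]), ?_, ?_⟩
  · intro hr0
    have hr0' : r = 0 := PadicInt.coe_eq_zero.mp hr0
    have hu0 : (u : ℚ_[3]) = 0 := by rw [hr, hr0']; simp
    have : (1 : ℚ_[3]) - ε = 0 := by simpa [hu] using hu0
    have hε1 : ε = 1 := (sub_eq_zero.mp this).symm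
    rw [hε1, norm_one] at hε
    exact lt_irrefl _ hε
  · have hrr : ((r : ℚ_[3])) ^ 2 = 1 - ε := by
      have : ((u : ℤ_[3]) : ℚ_[3]) = (r : ℚ_[3]) * (r : ℚ_[3]) := by rw [hr]; push_cast; ring
      rw [pow_two, ← this]
    have h4 : (4 : ℚ_[3]) * s₂ ≠ 0 := mul_ne_zero (by norm_num) hs
    calc s₁ ^ 2 - 4 * s₂ = -(4 * s₂) * (1 - ε) := by rw [hε_def]; field_simp; ring
      _ = -s₂ * (2 * (r : ℚ_[3])) ^ 2 := by rw [← hrr]; ring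

end Summit.HodgeConjecture.HodgeConjecture.HodgeLocus.Census.QF3
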